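import Summits.CriticalPhenomena.PercolationContinuityZ3.Theorems.PercNearOneGluingNoHeavyLowerTailAntitheticTwoStageEdge
import Summits.CriticalPhenomena.PercolationContinuityZ3.Theorems.PercNearOneGluingNoHeavyLowerTailAntitheticTwoStageCone
import HarnessLib

/-!
# `NoHeavyLowerTail` (stmt-CriticalPhenomena-4575) — antithetic cluster pairs: THEOREM 2S ∘ THEOREM R —
# the vertex antithetic inequality for (ANY side containing `sy`) ∥ (ROOTED CONE), all `G₁ ∋ sy`, all `H₂` (HOME/THEOREM-2S.md, prim-hp-2 gen 60)

Support file (`--supports stmt-CriticalPhenomena-4575`, hull-port prover `prim-hp-2`, gen 60).  No definitions, no named facts, no sorries;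
standard axioms.  VERTEX version, setting of …AntitheticTwoStageEdge / …AntitheticTwoStageCone.

* `Antithetic.TwoStage.edge_cone_change_nonneg` — THEOREM 2S (`TwoStage.edge_change_nonneg`) with hypothesis (H2) DISCHARGED by THEOREM R
  (`TwoStage.Cone.R_associated`): CHANGE ≥ 0 over a cut composite `E₁ ∪ E₂` whenever `sy ∈ E₁` and side 2 contains every spoke `sv`, `v ∈ U₂`
  (a rooted cone `s * H₂`, `H₂` arbitrary on `U₂`, `z ∈ U₂`).  Side 1 is otherwise ARBITRARY.
* `Antithetic.TwoStage.edge_cone_vertex_sum_nonneg` — the vertex antithetic inequality at `R = {x}` for `(E₁ ∪ E₂) + xy + xz` under the same hypotheses.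
* **`Antithetic.TwoStage.edgeCone_vertex_sum_nonneg`** — the headline family: `G₁` ANY graph on `{s, y} ∪ W` containing the edge `sy`, `G₂` any
  graph on `{s, z} ∪ W₂` containing all spokes from `s` (`= s * H₂`), `x ~ y, z`:
  `0 ≤ Σ_{ω : ¬(x ∈ X ω ∧ x ∈ Y ω)} (F(X ω) − F(Y ω))(G(X ω) − G(Y ω))` for all monotone `F, G`.  This is CONJECTURE Δ2 / the vertex
  antithetic conjecture at `R = {x}` for every `G₁ ∪_s (s * H₂) + x` (THEOREM FAT, apex ∥ fan, apex ∥ cone are special cases).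
[cite: VandenbergHaggstromKahn2005, Thm. 1.3 (p. 6), §1 p. 6 ("Harris' inequality")]
-/

noncomputable section

namespace Summit.CriticalPhenomena.PercolationContinuityZ3.Theorems

open Literature.Probability.Percolation
open scoped Classical

namespace Antithetic

namespace TwoStage

variable {V : Type*} [Fintype V]

/-- **THEOREM 2S ∘ THEOREM R, CHANGE form**: CHANGE ≥ 0 over a cut composite with `sy ∈ E₁` and a rooted cone on the `z`-side; side 1 otherwise
arbitrary. [this work] -/
theorem edge_cone_change_nonneg (E₁ E₂ : Set (Sym2 V)) (s y z x : V) (U₁ U₂ : Set V) (hU : Disjoint U₁ U₂) (hs₁ : s ∉ U₁)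
    (hs₂ : s ∉ U₂) (hE₁ : ∀ e ∈ E₁, ∀ v ∈ e, v = s ∨ v ∈ U₁) (hE₂ : ∀ e ∈ E₂, ∀ v ∈ e, v = s ∨ v ∈ U₂)
    (hdis : Disjoint E₁ E₂) (hy : y ∈ U₁) (hz : z ∈ U₂) (hsy : s(s, y) ∈ E₁)
    (hsp : ∀ v ∈ U₂, s(s, v) ∈ E₂)
    {F G : Set V → ℝ} (hF : Monotone F) (hG : Monotone G) :
    0 ≤ ∑ ω ∈ Finset.univ.filter (fun ω : Set (Sym2 V) =>
        ¬ ((openGraph (ω ∩ (E₁ ∪ E₂))).Reachable s y ∧ (openGraph (ωᶜ ∩ (E₁ ∪ E₂))).Reachable s z)),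
      (F (openCluster (ω ∩ (E₁ ∪ E₂)) s ∪ {v | v ∈ ({x} : Set V) ∧ y ∈ openCluster (ω ∩ (E₁ ∪ E₂)) s}) -
          F (openCluster (ωᶜ ∩ (E₁ ∪ E₂)) s ∪ {v | v ∈ ({x} : Set V) ∧ z ∈ openCluster (ωᶜ ∩ (E₁ ∪ E₂)) s})) *
        (G (openCluster (ω ∩ (E₁ ∪ E₂)) s ∪ {v | v ∈ ({x} : Set V) ∧ y ∈ openCluster (ω ∩ (E₁ ∪ E₂)) s}) -
          G (openCluster (ωᶜ ∩ (E₁ ∪ E₂)) s ∪ {v | v ∈ ({x} : Set V) ∧ z ∈ openCluster (ωᶜ ∩ (E₁ ∪ E₂)) s})) :=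
  edge_change_nonneg E₁ E₂ s y z x U₁ U₂ hU hs₁ hs₂ hE₁ hE₂ hdis hy hz hsy
    (fun Φ₁ Φ₂ hΦ₁ hΦ₂ => Cone.R_associated E₂ s z (Cone.hcone_of_cone E₂ s z U₂ hE₂ hz hsp) Φ₁ Φ₂ hΦ₁ hΦ₂) hF hG

section Vertex

variable {E : Set (Sym2 V)} {s x y z : V} (hxs : x ≠ s) (hxy : x ≠ y) (hxz : x ≠ z) (hyz : y ≠ z)
  (he : s(x, y) ∈ E) (hf : s(x, z) ∈ E) (hdeg : ∀ h ∈ E, x ∈ h → h = s(x, y) ∨ h = s(x, z)) (hg : s(y, z) ∉ E)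
include hxs hxy hxz hyz he hf hdeg hg

/-- **THEOREM 2S ∘ THEOREM R, vertex form**: `x` of degree 2 with neighbours `y ≠ z` (`yz ∉ E`); `E ∖ {xy, xz} = E₁ ∪ E₂` glued at `s` only,
`sy ∈ E₁`, side 2 a rooted cone at `s` through `z`.  The vertex antithetic sum over `D({x})` is nonnegative for all monotone `F, G`. [this work] -/
theorem edge_cone_vertex_sum_nonneg (E₁ E₂ : Set (Sym2 V)) (U₁ U₂ : Set V) (hE' : E \ {s(x, y), s(x, z)} = E₁ ∪ E₂)
    (hU : Disjoint U₁ U₂) (hs₁ : s ∉ U₁) (hs₂ : s ∉ U₂) (hE₁ : ∀ e ∈ E₁, ∀ v ∈ e, v = s ∨ v ∈ U₁)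
    (hE₂ : ∀ e ∈ E₂, ∀ v ∈ e, v = s ∨ v ∈ U₂) (hdis : Disjoint E₁ E₂) (hyU : y ∈ U₁) (hzU : z ∈ U₂) (hsy : s(s, y) ∈ E₁)
    (hsp : ∀ v ∈ U₂, s(s, v) ∈ E₂)
    {F G : Set V → ℝ} (hF : Monotone F) (hG : Monotone G) :
    0 ≤ ∑ ω ∈ Finset.univ.filter (fun ω : Set (Sym2 V) =>
        ¬ ((openGraph (ω ∩ E)).Reachable s x ∧ (openGraph (ωᶜ ∩ E)).Reachable s x)),
      (F (openCluster (ω ∩ E) s) - F (openCluster (ωᶜ ∩ E) s)) * (G (openCluster (ω ∩ E) s) - G (openCluster (ωᶜ ∩ E) s)) :=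
  edge_vertex_sum_nonneg hxs hxy hxz hyz he hf hdeg hg E₁ E₂ U₁ U₂ hE' hU hs₁ hs₂ hE₁ hE₂ hdis hyU hzU hsy
    (fun Φ₁ Φ₂ hΦ₁ hΦ₂ => Cone.R_associated E₂ s z (Cone.hcone_of_cone E₂ s z U₂ hE₂ hzU hsp) Φ₁ Φ₂ hΦ₁ hΦ₂) hF hG

end Vertex

/-- **Any side with the edge `sy` ∥ rooted cone** (THEOREM 2S ∘ THEOREM R, HOME/THEOREM-2S.md COROLLARY): `G₁` ANY graph on `{s, y} ∪ W`
with `y ~ s`; `G₂` any graph on `{s, z} ∪ W₂` containing every spoke `sv` (`v ∈ {z} ∪ W₂`) and no loop at `s`; `x ~ y, z`.  The vertex antithetic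
inequality at `R = {x}` — for ALL such `G₁, G₂` (i.e. `G₁ ∪_s (s * H₂) + x`, all `G₁ ∋ sy`, all `H₂`). [this work] -/
theorem edgeCone_vertex_sum_nonneg (E E₁ E₂ : Set (Sym2 V)) (s x y z : V) (W W₂ : Set V)
    (hsx : s ≠ x) (hsy : s ≠ y) (hsz : s ≠ z) (hxy : x ≠ y) (hxz : x ≠ z) (hyz : y ≠ z)
    (hsW : s ∉ W) (hxW : x ∉ W) (hyW : y ∉ W) (hzW : z ∉ W) (hsW₂ : s ∉ W₂) (hxW₂ : x ∉ W₂) (hyW₂ : y ∉ W₂)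
    (hWW : Disjoint W W₂)
    (hE₁ : ∀ e ∈ E₁, ∀ v ∈ e, v = s ∨ v ∈ ({v | v = y ∨ v ∈ W} : Set V)) (hsyE : s(s, y) ∈ E₁)
    (hE₂ : ∀ e ∈ E₂, ∀ v ∈ e, v = s ∨ v ∈ ({v | v = z ∨ v ∈ W₂} : Set V)) (hloop : s(s, s) ∉ E₂)
    (hsp : ∀ v ∈ ({v | v = z ∨ v ∈ W₂} : Set V), s(s, v) ∈ E₂)
    (hE : ∀ e, e ∈ E ↔ e ∈ E₁ ∨ e ∈ E₂ ∨ e = s(x, y) ∨ e = s(x, z))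
    {F G : Set V → ℝ} (hF : Monotone F) (hG : Monotone G) :
    0 ≤ ∑ ω ∈ Finset.univ.filter (fun ω : Set (Sym2 V) =>
        ¬ ((openGraph (ω ∩ E)).Reachable s x ∧ (openGraph (ωᶜ ∩ E)).Reachable s x)),
      (F (openCluster (ω ∩ E) s) - F (openCluster (ωᶜ ∩ E) s)) * (G (openCluster (ω ∩ E) s) - G (openCluster (ωᶜ ∩ E) s)) := by
  -- `x` occurs in neither side
  have hx₁ : ∀ e ∈ E₁, x ∉ e := fun e he hx => by
    rcases hE₁ e he x hx with h | (h | h)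
    · exact hsx h.symm
    · exact hxy h
    · exact hxW h
  have hx₂ : ∀ e ∈ E₂, x ∉ e := fun e he hx => by
    rcases hE₂ e he x hx with h | (h | h)
    · exact hsx h.symm
    · exact hxz h
    · exact hxW₂ h
  have he : s(x, y) ∈ E := (hE _).2 (Or.inr (Or.inr (Or.inl rfl)))
  have hf : s(x, z) ∈ E := (hE _).2 (Or.inr (Or.inr (Or.inr rfl)))
  have hdeg : ∀ h ∈ E, x ∈ h → h = s(x, y) ∨ h = s(x, z) := by
    intro h hh hxh
    rcases (hE h).1 hh with h1 | h1 | h1 | h1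
    · exact absurd hxh (hx₁ h h1)
    · exact absurd hxh (hx₂ h h1)
    · exact Or.inl h1
    · exact Or.inr h1
  have hU : Disjoint ({v | v = y ∨ v ∈ W} : Set V) {v | v = z ∨ v ∈ W₂} := by
    rw [Set.disjoint_left]
    rintro v (rfl | hv) (h | h)
    · exact hyz h
    · exact hyW₂ h
    · exact hzW (h ▸ hv)
    · exact Set.disjoint_left.1 hWW hv h
  have hs₁ : s ∉ ({v | v = y ∨ v ∈ W} : Set V) := by rintro (h | h); exacts [hsy h, hsW h]
  have hs₂ : s ∉ ({v | v = z ∨ v ∈ W₂} : Set V) := by rintro (h | h); exacts [hsz h, hsW₂ h]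
  have hdis : Disjoint E₁ E₂ := by
    rw [Set.disjoint_left]
    intro e he₁ he₂
    -- a pair of `E₁ ∩ E₂` has all entries equal to `s`, i.e. it is the loop at `s`
    have hall : ∀ v ∈ e, v = s := fun v hv => by
      rcases hE₁ e he₁ v hv with h | h
      · exact h
      · rcases hE₂ e he₂ v hv with h' | h'
        · exact h'
        · exact absurd h' (Set.disjoint_left.1 hU h)
    have hloop' : e = s(s, s) := by
      induction e using Sym2.ind with
      | h a b => rw [hall a (Sym2.mem_mk_left a b), hall b (Sym2.mem_mk_right a b)]
    exact hloop (hloop' ▸ he₂)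
  have hg : s(y, z) ∉ E := by
    intro h
    rcases (hE _).1 h with h1 | h1 | h1 | h1
    · rcases hE₁ _ h1 z (Sym2.mem_mk_right _ _) with h2 | h2
      · exact hsz h2.symm
      · exact Set.disjoint_left.1 hU h2 (Or.inl rfl)
    · rcases hE₂ _ h1 y (Sym2.mem_mk_left _ _) with h2 | h2
      · exact hsy h2.symm
      · exact Set.disjoint_right.1 hU h2 (Or.inl rfl)
    · rw [Sym2.eq_iff] at h1
      rcases h1 with ⟨h2, _⟩ | ⟨_, h2⟩
      · exact hxy h2.symm
      · exact hxz h2.symm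
    · rw [Sym2.eq_iff] at h1
      rcases h1 with ⟨h2, _⟩ | ⟨h2, _⟩
      · exact hxy h2.symm
      · exact hyz h2
  have hE' : E \ {s(x, y), s(x, z)} = E₁ ∪ E₂ := by
    ext e
    simp only [Set.mem_sdiff, Set.mem_insert_iff, Set.mem_singleton_iff, Set.mem_union, not_or]
    constructor
    · rintro ⟨heE, h1, h2⟩
      rcases (hE e).1 heE with h | h | h | h
      · exact Or.inl h
      · exact Or.inr h
      · exact absurd h h1
      · exact absurd h h2
    · intro h
      refine ⟨(hE e).2 (h.elim Or.inl (fun h => Or.inr (Or.inl h))), fun h1 => ?_, fun h2 => ?_⟩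
      · rcases h with h | h
        · exact hx₁ e h (h1 ▸ Sym2.mem_mk_left x y)
        · exact hx₂ e h (h1 ▸ Sym2.mem_mk_left x y)
      · rcases h with h | h
        · exact hx₁ e h (h2 ▸ Sym2.mem_mk_left x z)
        · exact hx₂ e h (h2 ▸ Sym2.mem_mk_left x z)
  exact edge_cone_vertex_sum_nonneg hsx.symm hxy hxz hyz he hf hdeg hg E₁ E₂ {v | v = y ∨ v ∈ W} {v | v = z ∨ v ∈ W₂} hE' hU hs₁ hs₂
    hE₁ hE₂ hdis (Or.inl rfl) (Or.inl rfl) hsyE hsp hF hG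

end TwoStage

end Antithetic

end Summit.CriticalPhenomena.PercolationContinuityZ3.Theorems
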